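import Summits.QuantumFields.BalabanUV.Beta.LinearizingChange267FromQ
import Literature.MathematicalPhysics.QuantumFieldTheory.Balaban1983to89.B11Prop6Scheme

/-!
# `T4Continuum.ShellMeasureLocalGradientTail` — WALL §2 (a) item (P4), its ONE-GRID FACE (generic core): the 2-TAIL
# `G − G(0) − DG(0)` of a bounded analytic map has the (98) SHAPE `B11Prop6Scheme.Prop4Hyp`, and for a SUM OF LOCAL
# PLAQUETTE FUNCTIONALS the bond-localised derivative keeps a VOLUME-FREE constant (incidence × one plaquette)
# (cell `pub-balaban`, sub-cell `t4`, spine estimate NE7c (node U5b), owner lineage `b2b-balaban-t4-ne7c-p1` gen 29,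
# table `LEAVES-NE7c-P1.md` row S62 file 1; imports row D4's `Beta/LinearizingChange267FromQ` (`nonlin`,
# `nonlin_sq_bound`) and `B11Prop6Scheme` (`Prop4Hyp`, and through it `B8SectDSource.norm_fderiv_le_of_norm_le`);
# [folklore]; 0 sorry)

HONEST FRAMING.  Finite four-torus programme, rung (B)+1 only — NOT infinite volume, NOT a mass gap, NOT the Clay
problem, NOT summit progress; (B), `BetaPertHyp`, (B^μ) are not consumed.  NE7c (`T4IndicatorShell.ShellWeightBound`)
is NOT PRINTED and NOT PROVED; «NE7c ⇐ the named binders» (WALL `t4/b2b-balaban-t4-ne7c-p1/WALL-NE7c-P1.md` §2).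
ELEMENTARY COMPLEX ANALYSIS on complex normed spaces ([folklore]); nothing printed is asserted or cited as a fact; no
`def … : Prop` is minted (the three `def`s are DATA: the 2-tail of a map, the single-bond direction, the bond-localised
derivative).  HONEST DEPENDENCY (cell): continuum YM on T⁴ ⇐ BetaPertH ∧ nine spine estimates (0/9 proved); BetaPertH ⇐
(D1) ∧ (D4) ∧ CAP+tail; G-an2-4 gates asym, D1 and NE2/3/4.

THE POINT.  END-II of record `ShellMeasureLandauHolonomyPrint.slotAC_realized_su2_landauChart_print` displays, per
exterior section `V`, the binder `hW : ∀ V, Prop4Hyp (W𝒱 V) C₄ a₃` — WALL §2 (a) item (P4): [Balaban1985Variational]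
(cell paper B11) Proposition 4, pp. 292–293, verbatim (render `b2b-balaban-ref1/pages/1985-cmp102-variational-
background/…-p016/p017-x2.png`, transcript `HOME/b2b-balaban-b11/transcript.md` l. 75): *«Let us consider the functional
V(A′) on the space of configurations A′ with values in the complexified Lie algebra gᶜ, and satisfying the inequalities
(77) … for ε₃ ≤ a₃ … The functional derivative of V(A′) is an analytic function on this space, and satisfies the estimate
|((δ∕δA′)V)(A′)| < C₄ε₃²(Lʲη)⁻³ on Ω_j, j = 0, 1, …, k. (97) The constants a₃, C₄ depend on d and L only. … |((δ∕δA′)V)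
(A′)|_{(−3)} ≤ C₄(max{|A′|_{(−1)}, |∇A′|_{(−2)}})², (98)»*, where `V` = *«all terms of order ≥ 3»* of the expansion
(81) of the action in the chart (p. 290, (80)), and of its proof the plaquette line p. 291, (90): *«((δ∕δA(b))V₀′)(A′ −
HD(A′)) = Σ_{p ∈ st(b)} …, where st(b) denotes a set of plaquettes p such that b ⊂ ∂p. The derivative ((d∕dA(b))V₀′)(A,
∂p) satisfies a bound similar to the bound (40) for the function V₀′(A, ∂p), but with the power of |A| lower by 1»*.
These sentences are LOCATORS ONLY (the paper is under adjudication; ABSOLUTE RULE).  WHAT THIS FILE PROVES is the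
elementary mechanism behind (90)∕(98) AT ONE GRID (the case `Lʲη = η` of (97), sup norms), for ABSTRACT data:
* §1 `tail₂ G := G − G(0) − DG(0)` — for `G` the gradient map of an analytic potential this is the gradient of the
  potential's «terms of order ≥ 3».  `norm_tail₂_le`: `G` complex-differentiable with `‖G‖ ≤ M` on `ball 0 R` ⟹
  `‖tail₂ G x‖ ≤ (4M∕R²)‖x‖²` there (row D4's `nonlin_sq_bound` on `G − G(0)`); **`prop4Hyp_tail₂`**:
  `Prop4Hyp (tail₂ G) (4M∕R²) R` — the (98) SHAPE for the 2-tail of ANY bounded analytic map; `tail₂_sum`,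
  `tail₂_congr` (locality in the domain), `tail₂_pi_apply` (coordinatewise in a finite product).
* §2 bond fields `A : Λ → 𝔄` (`Λ` finite, sup norm): the single-bond direction `sgl b` (`Pi.single` as a linear
  isometry), the BOND-LOCALISED DERIVATIVE `locGrad V A b := DV(A) ∘ sgl b` (B11's `(δ∕δA(b))V` read as a functional on
  the fibre; `fderiv_apply_eq_sum_locGrad`: nothing is lost); LOCALITY `fderiv_comp_sgl_eq_zero` (a functional blind
  to the bonds off `S` has zero derivative in those directions) ⟹ **`locGrad_sum_eq_filter`** = the display (90):
  only `st(b) = {p : b ∈ supp p}` contributes; the one-plaquette-one-bond Cauchy bounds `norm_fderiv_comp_sgl_le`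
  (`2M₀∕R` on `ball 0 (R∕2)`) and `norm_tail₂_fderiv_comp_sgl_le` (`(32M₀∕R³)‖A‖²`); **`norm_tail₂_locGrad_le`** and
  **`prop4Hyp_locGrad`**: for `V = Σ_{p ∈ Pl} φ_p` with every `φ_p` analytic and bounded by `M₀` on `ball 0 R` and
  local to `supp p`, `#st(b) ≤ m` for every bond, `Prop4Hyp (tail₂ (locGrad V)) (32·m·M₀∕R³) (R∕2)` — the constant is
  INCIDENCE × ONE PLAQUETTE, independent of `#Pl` and `#Λ` (the volume), which is the one-grid content of «C₄ depends
  on d and L only».  File 2 (`ShellMeasureWilsonGradientTail`) instantiates `φ_p` with the Wilson plaquette functional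
  `A ↦ τ(1 − (e^{iA}U₀)(∂p))` at any unit-bounded background via the gen-28 `ExpWord` engine.
NOT HERE (and said in every headline): the MULTI-SCALE gain of (97) on `Ω_j`, `j ≥ 1` — it needs the covariant-
derivative split (39)∕(40) of `V₀(A, ∂p)` (pp. 284–285; [6] = B8 (1.50)∕(1.52)) and the weighted norms `|·|_{(−1)}`,
`|∇·|_{(−2)}`, `|·|_{(−3)}` of the `(Ω_j)` geometry; the `HD`-terms of (80) ((85)–(89): they consume `H` = [5] Thm 3.12 =
WALL item (46), the deep wall, and `D` = the `Cf` item = [4] Prop. 4, rows S55∕S56); the commutator terms (91)–(96); the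
identification of `W𝒱 V` with the tail of Bałaban's sectioned `V` (node O, [dict]).  So this is the j = 0 KERNEL FACE of
ONE W-a binder's plaquette part — exactly as `ShellMeasureWilsonLedger.levelLedger_wilson_su2_levelZero` is the j = 0
face of (M1); no estimate of Bałaban's at a live level is discharged.
-/

noncomputable section

open Metric Set Filter
open scoped Topology

namespace Summit.QuantumFields.BalabanUV.T4Continuum.ShellMeasureLocalGradientTail

open Literature.MathematicalPhysics.QuantumFieldTheory.Balaban1983to89
open B11Prop6Scheme (Prop4Hyp)
open B8SectDSource (norm_fderiv_le_of_norm_le)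
open Summit.QuantumFields.BalabanUV.Beta.LinearizingChange267FromQ (nonlin nonlin_sq_bound)

variable {E F : Type*} [NormedAddCommGroup E] [NormedSpace ℂ E] [NormedAddCommGroup F] [NormedSpace ℂ F]

/-! ## §1 The 2-tail `G − G(0) − DG(0)` of an analytic map: the (98) SHAPE -/

/-- The 2-TAIL of a map at the origin: `tail₂ G x = G x − G 0 − DG(0)x` (the order-≥2 part of `G`; for `G` = the
gradient map of a potential, the gradient of the potential's order-≥3 part). [folklore] -/
def tail₂ (G : E → F) : E → F := fun x => G x - G 0 - fderiv ℂ G 0 x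

/-- Unfolding. [folklore] -/
theorem tail₂_apply (G : E → F) (x : E) : tail₂ G x = G x - G 0 - fderiv ℂ G 0 x := rfl

/-- `tail₂ G 0 = 0`. [folklore] -/
theorem tail₂_zero (G : E → F) : tail₂ G 0 = 0 := by simp [tail₂]

/-- `tail₂ G` is row D4's `nonlin` of the re-centred map `G − G(0)`. [folklore] -/
theorem tail₂_eq_nonlin (G : E → F) : tail₂ G = nonlin (fun x => G x - G 0) := by
  funext x
  simp only [tail₂, nonlin, fderiv_sub_const]

/-- `tail₂` is differentiable where `G` is. [folklore] -/
theorem differentiableOn_tail₂ {G : E → F} {s : Set E} (hG : DifferentiableOn ℂ G s) :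
    DifferentiableOn ℂ (tail₂ G) s :=
  (hG.sub_const (G 0)).sub (fderiv ℂ G 0).differentiable.differentiableOn

/-- `tail₂` is analytic where `G` is. [folklore] -/
theorem analyticOnNhd_tail₂ {G : E → F} {s : Set E} (hG : AnalyticOnNhd ℂ G s) :
    AnalyticOnNhd ℂ (tail₂ G) s := fun z hz =>
  ((hG z hz).sub analyticAt_const).sub ((fderiv ℂ G 0).analyticAt z)

/-- `D(tail₂ G)(0) = 0`. [folklore] -/
theorem hasFDerivAt_tail₂_zero {G : E → F} (hG : DifferentiableAt ℂ G 0) :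
    HasFDerivAt (tail₂ G) (0 : E →L[ℂ] F) 0 := by
  have h := (hG.hasFDerivAt.sub_const (G 0)).sub (fderiv ℂ G 0).hasFDerivAt
  rw [sub_self] at h
  exact h

/-- `tail₂` of a finite sum is the sum of the `tail₂`'s (each summand differentiable at `0`). [folklore] -/
theorem tail₂_sum {ι : Type*} (s : Finset ι) {G : ι → E → F} (hG : ∀ i ∈ s, DifferentiableAt ℂ (G i) 0)
    (x : E) : tail₂ (fun x => ∑ i ∈ s, G i x) x = ∑ i ∈ s, tail₂ (G i) x := by
  have hf : (fun x => ∑ i ∈ s, G i x) = ∑ i ∈ s, G i := by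
    funext y
    simp
  have hD : fderiv ℂ (fun x => ∑ i ∈ s, G i x) 0 = ∑ i ∈ s, fderiv ℂ (G i) 0 := by
    rw [hf]
    exact fderiv_sum hG
  simp only [tail₂, hD]
  rw [show (∑ i ∈ s, fderiv ℂ (G i) 0) x = ∑ i ∈ s, fderiv ℂ (G i) 0 x from by
    simp]
  rw [Finset.sum_sub_distrib, Finset.sum_sub_distrib]

/-- `tail₂` at `x` only sees `G` near `0` and at `x`. [folklore] -/
theorem tail₂_congr {G₁ G₂ : E → F} (h0 : G₁ =ᶠ[𝓝 0] G₂) {x : E} (hx : G₁ x = G₂ x) :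
    tail₂ G₁ x = tail₂ G₂ x := by
  simp only [tail₂, hx, h0.eq_of_nhds, h0.fderiv_eq]

/-- `tail₂` of a map into a finite product, coordinatewise. [folklore] -/
theorem tail₂_pi_apply {ι : Type*} [Fintype ι] {F' : ι → Type*} [∀ i, NormedAddCommGroup (F' i)]
    [∀ i, NormedSpace ℂ (F' i)] {W : E → ∀ i, F' i} (hW : ∀ i, DifferentiableAt ℂ (fun x => W x i) 0)
    (x : E) (i : ι) : tail₂ W x i = tail₂ (fun x => W x i) x := by
  have hD : fderiv ℂ W 0 = ContinuousLinearMap.pi fun i => fderiv ℂ (fun x => W x i) 0 :=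
    fderiv_pi (φ := fun i x => W x i) hW
  simp only [tail₂, Pi.sub_apply, hD, ContinuousLinearMap.pi_apply]

variable [CompleteSpace F]

/-- **CAUCHY BOUND FOR THE 2-TAIL.**  `G` complex-differentiable with `‖G‖ ≤ M` on `ball 0 R` ⟹
`‖tail₂ G x‖ ≤ (4M∕R²)‖x‖²` on the ball (row D4's `nonlin_sq_bound` applied to `G − G(0)`, bounded by `2M`). [folklore] -/
theorem norm_tail₂_le {G : E → F} {R M : ℝ} (hR : 0 < R) (hG : DifferentiableOn ℂ G (ball 0 R))
    (hM : ∀ z ∈ ball (0 : E) R, ‖G z‖ ≤ M) :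
    ∀ x ∈ ball (0 : E) R, ‖tail₂ G x‖ ≤ 4 * M / R ^ 2 * ‖x‖ ^ 2 := by
  intro x hx
  have h0 : (0 : E) ∈ ball (0 : E) R := mem_ball_self hR
  have hd : DifferentiableOn ℂ (fun x => G x - G 0) (ball 0 R) := hG.sub_const (G 0)
  have hb : ∀ z ∈ ball (0 : E) R, ‖G z - G 0‖ ≤ 2 * M := fun z hz =>
    (norm_sub_le _ _).trans (by linarith [hM z hz, hM 0 h0])
  have h := nonlin_sq_bound hR hd hb (by simp) x hx
  rw [tail₂_eq_nonlin]
  calc ‖nonlin (fun x => G x - G 0) x‖ ≤ 2 * (2 * M) / R ^ 2 * ‖x‖ ^ 2 := h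
    _ = 4 * M / R ^ 2 * ‖x‖ ^ 2 := by ring

/-- **THE (98) SHAPE** ([Balaban1985Variational] Prop. 4, `B11Prop6Scheme.Prop4Hyp`, the hypothesis `hW` of END-II
`ShellMeasureLandauHolonomyPrint.slotAC_realized_su2_landauChart_print`) FOR THE 2-TAIL OF ANY BOUNDED ANALYTIC MAP:
`G` complex-differentiable with `‖G‖ ≤ M` on `ball 0 R` ⟹ `Prop4Hyp (tail₂ G) (4M∕R²) R`.  (Locator only: when `G` is the
gradient map of an analytic potential, `tail₂ G` is the gradient of its «terms of order ≥ 3» — the TYPE of (80)–(81)'s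
`V`.)  Nothing printed is asserted. [folklore] -/
theorem prop4Hyp_tail₂ {G : E → F} {R M : ℝ} (hR : 0 < R) (hG : DifferentiableOn ℂ G (ball 0 R))
    (hM : ∀ z ∈ ball (0 : E) R, ‖G z‖ ≤ M) : Prop4Hyp (tail₂ G) (4 * M / R ^ 2) R where
  quad Y hY := norm_tail₂_le hR hG hM Y (mem_ball_zero_iff.2 hY)
  differentiableOn := by
    have h : {Y : E | ‖Y‖ < R} = ball (0 : E) R := by
      ext Y
      simp
    rw [h]
    exact differentiableOn_tail₂ hG

/-! ## §2 Bond-LOCAL sums: the constant is (incidence) × (one plaquette), VOLUME-FREE -/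

section Local

variable {Λ : Type*} [Fintype Λ] [DecidableEq Λ] {𝔄 : Type*} [NormedAddCommGroup 𝔄] [NormedSpace ℂ 𝔄]

/-- The single-bond direction `X ↦ (0, …, X at b, …, 0)` as a continuous linear map (a linear isometry). [folklore] -/
abbrev sgl (b : Λ) : 𝔄 →L[ℂ] (Λ → 𝔄) := (LinearIsometry.single ℂ (fun _ : Λ => 𝔄) b).toContinuousLinearMap

omit [Fintype Λ] in
/-- `sgl b X = Pi.single b X`. [folklore] -/
theorem sgl_apply [Fintype Λ] (b : Λ) (X : 𝔄) : sgl b X = Pi.single b X := rfl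

/-- `‖sgl b‖ ≤ 1`. [folklore] -/
theorem norm_sgl_le (b : Λ) : ‖(sgl b : 𝔄 →L[ℂ] (Λ → 𝔄))‖ ≤ 1 :=
  (LinearIsometry.single ℂ (fun _ : Λ => 𝔄) b).norm_toContinuousLinearMap_le

/-- **THE BOND-LOCALISED FUNCTIONAL DERIVATIVE** of a functional `V` of the bond field `A : Λ → 𝔄`:
`locGrad V A b := DV(A) ∘ ι_b ∈ (𝔄 →L[ℂ] ℂ)` — the derivative of `V` at `A` in the directions supported on the one bond `b`
(B11's `(δ∕δA(b))V`, read as a functional on the fibre instead of through the trace pairing). [folklore] -/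
def locGrad (V : (Λ → 𝔄) → ℂ) (A : Λ → 𝔄) : Λ → (𝔄 →L[ℂ] ℂ) := fun b => (fderiv ℂ V A).comp (sgl b)

/-- Unfolding. [folklore] -/
theorem locGrad_apply (V : (Λ → 𝔄) → ℂ) (A : Λ → 𝔄) (b : Λ) :
    locGrad V A b = (fderiv ℂ V A).comp (sgl b) := rfl

/-- `locGrad V A b X = DV(A)(Pi.single b X)`. [folklore] -/
theorem locGrad_apply_apply (V : (Λ → 𝔄) → ℂ) (A : Λ → 𝔄) (b : Λ) (X : 𝔄) :
    locGrad V A b X = fderiv ℂ V A (Pi.single b X) := rfl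

/-- NOTHING IS LOST: the full derivative is the sum of the bond-local ones, `DV(A)H = Σ_b locGrad V A b (H b)`
(`H = Σ_b Pi.single b (H b)`). [folklore] -/
theorem fderiv_apply_eq_sum_locGrad (V : (Λ → 𝔄) → ℂ) (A H : Λ → 𝔄) :
    fderiv ℂ V A H = ∑ b, locGrad V A b (H b) := by
  conv_lhs => rw [← Finset.univ_sum_single H]
  rw [map_sum]
  rfl

/-- LOCALITY (B11 p. 291: `V₀′(A, ∂p)` depends on the bond variables of `∂p` only): a functional that does not see the
bonds outside `S` — `ψ (A + Pi.single b X) = ψ A` for `b ∉ S` — has zero derivative in every single-bond direction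
`b ∉ S`. [folklore] -/
theorem fderiv_comp_sgl_eq_zero {ψ : (Λ → 𝔄) → ℂ} {S : Finset Λ}
    (hψ : ∀ A : Λ → 𝔄, ∀ b ∉ S, ∀ X : 𝔄, ψ (A + Pi.single b X) = ψ A) {A : Λ → 𝔄}
    (hd : DifferentiableAt ℂ ψ A) {b : Λ} (hb : b ∉ S) : (fderiv ℂ ψ A).comp (sgl b) = 0 := by
  ext X
  have h1 : HasDerivAt (fun t : ℂ => A + t • (sgl b X : Λ → 𝔄)) ((1 : ℂ) • (sgl b X : Λ → 𝔄)) 0 :=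
    ((hasDerivAt_id (0 : ℂ)).smul_const _).const_add A
  have h2 : HasFDerivAt ψ (fderiv ℂ ψ A) (A + (0 : ℂ) • (sgl b X : Λ → 𝔄)) := by
    rw [zero_smul, add_zero]
    exact hd.hasFDerivAt
  have hline : HasDerivAt (fun t : ℂ => ψ (A + t • (sgl b X : Λ → 𝔄))) (fderiv ℂ ψ A (sgl b X)) 0 := by
    simpa [Function.comp_def] using h2.comp_hasDerivAt (0 : ℂ) h1
  have hconst : (fun t : ℂ => ψ (A + t • (sgl b X : Λ → 𝔄))) = fun _ => ψ A := by
    funext t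
    have ht : t • (sgl b X : Λ → 𝔄) = Pi.single b (t • X) := by
      rw [sgl_apply, Pi.single_smul]
    rw [ht, hψ A b hb]
  rw [hconst] at hline
  have h := hline.unique (hasDerivAt_const (0 : ℂ) (ψ A))
  simpa using h

variable {P : Type*} (Pl : Finset P) (φ : P → (Λ → 𝔄) → ℂ) (supp : P → Finset Λ)

/-- The bond-local derivative of a finite sum of functionals differentiable at `A`. [folklore] -/
theorem locGrad_sum_apply {A : Λ → 𝔄} (hφ : ∀ p ∈ Pl, DifferentiableAt ℂ (φ p) A) (b : Λ) :
    locGrad (fun A => ∑ p ∈ Pl, φ p A) A b = ∑ p ∈ Pl, (fderiv ℂ (φ p) A).comp (sgl b) := by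
  have hf : (fun A => ∑ p ∈ Pl, φ p A) = ∑ p ∈ Pl, φ p := by
    funext y
    simp
  rw [locGrad_apply, hf, fderiv_sum hφ, ContinuousLinearMap.finsetSum_comp]

/-- **LOCALITY OF THE SUM'S DERIVATIVE** (B11 (90): «`(δ∕δA(b)) Σ_p V₀′(A, ∂p) = Σ_{p ∈ st(b)} …`, `st(b)` = the
plaquettes `p` with `b ⊂ ∂p`»): only the plaquettes whose support contains `b` contribute. [folklore] -/
theorem locGrad_sum_eq_filter {A : Λ → 𝔄} (hφ : ∀ p ∈ Pl, DifferentiableAt ℂ (φ p) A)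
    (hloc : ∀ p ∈ Pl, ∀ A : Λ → 𝔄, ∀ b ∉ supp p, ∀ X : 𝔄, φ p (A + Pi.single b X) = φ p A) (b : Λ) :
    locGrad (fun A => ∑ p ∈ Pl, φ p A) A b =
      ∑ p ∈ Pl.filter (fun p => b ∈ supp p), (fderiv ℂ (φ p) A).comp (sgl b) := by
  rw [locGrad_sum_apply Pl φ hφ, Finset.sum_filter]
  refine Finset.sum_congr rfl fun p hp => ?_
  by_cases hb : b ∈ supp p
  · rw [if_pos hb]
  · rw [if_neg hb, fderiv_comp_sgl_eq_zero (hloc p hp) (hφ p hp) hb]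

/-- One plaquette, one bond: `A ↦ Dφ_p(A) ∘ ι_b` is bounded by `2M₀∕R` on `ball 0 (R∕2)` when `‖φ_p‖ ≤ M₀` on `ball 0 R`
(the Cauchy estimate `B8SectDSource.norm_fderiv_le_of_norm_le` and `‖ι_b‖ ≤ 1`). [folklore] -/
theorem norm_fderiv_comp_sgl_le {ψ : (Λ → 𝔄) → ℂ} {R M₀ : ℝ} (hR : 0 < R)
    (hd : DifferentiableOn ℂ ψ (ball 0 R)) (hM : ∀ A ∈ ball (0 : Λ → 𝔄) R, ‖ψ A‖ ≤ M₀) (b : Λ)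
    {A : Λ → 𝔄} (hA : A ∈ ball (0 : Λ → 𝔄) (R / 2)) : ‖(fderiv ℂ ψ A).comp (sgl b)‖ ≤ 2 * M₀ / R := by
  have hM0 : 0 ≤ M₀ := (norm_nonneg _).trans (hM 0 (mem_ball_self hR))
  have hAR : ‖A‖ < R / 2 := mem_ball_zero_iff.1 hA
  have h1 : ‖fderiv ℂ ψ A‖ ≤ M₀ / (R - ‖A‖) := norm_fderiv_le_of_norm_le hd hM (by linarith)
  have h2 : M₀ / (R - ‖A‖) ≤ 2 * M₀ / R := by
    rw [div_le_div_iff₀ (by linarith) hR]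
    nlinarith [norm_nonneg A]
  calc ‖(fderiv ℂ ψ A).comp (sgl b)‖ ≤ ‖fderiv ℂ ψ A‖ * ‖(sgl b : 𝔄 →L[ℂ] (Λ → 𝔄))‖ :=
      ContinuousLinearMap.opNorm_comp_le _ _
    _ ≤ M₀ / (R - ‖A‖) * 1 := mul_le_mul h1 (norm_sgl_le b) (norm_nonneg _)
        (div_nonneg hM0 (by linarith))
    _ ≤ 2 * M₀ / R := by rw [mul_one]; exact h2

/-- One plaquette, one bond: the 2-tail of `A ↦ Dφ_p(A) ∘ ι_b` is bounded by `(32M₀∕R³)‖A‖²` on `ball 0 (R∕2)`.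
[folklore] -/
theorem norm_tail₂_fderiv_comp_sgl_le {ψ : (Λ → 𝔄) → ℂ} {R M₀ : ℝ} (hR : 0 < R)
    (ha : AnalyticOnNhd ℂ ψ (ball 0 R)) (hM : ∀ A ∈ ball (0 : Λ → 𝔄) R, ‖ψ A‖ ≤ M₀) (b : Λ) :
    ∀ A ∈ ball (0 : Λ → 𝔄) (R / 2),
      ‖tail₂ (fun A => (fderiv ℂ ψ A).comp (sgl b)) A‖ ≤ 32 * M₀ / R ^ 3 * ‖A‖ ^ 2 := by
  intro A hA
  have hR2 : 0 < R / 2 := by positivity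
  have hsub : ball (0 : Λ → 𝔄) (R / 2) ⊆ ball 0 R := ball_subset_ball (by linarith)
  have hd : DifferentiableOn ℂ (fun A => (fderiv ℂ ψ A).comp (sgl b)) (ball 0 (R / 2)) := by
    have h1 : AnalyticOnNhd ℂ (fderiv ℂ ψ) (ball 0 (R / 2)) := ha.fderiv.mono hsub
    exact ((ContinuousLinearMap.compL ℂ 𝔄 (Λ → 𝔄) ℂ).flip (sgl b)).differentiable.comp_differentiableOn
      h1.differentiableOn
  have hb : ∀ A ∈ ball (0 : Λ → 𝔄) (R / 2), ‖(fderiv ℂ ψ A).comp (sgl b)‖ ≤ 2 * M₀ / R := fun A hA =>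
    norm_fderiv_comp_sgl_le hR ha.differentiableOn hM b hA
  have h := norm_tail₂_le hR2 hd hb A hA
  calc _ ≤ 4 * (2 * M₀ / R) / (R / 2) ^ 2 * ‖A‖ ^ 2 := h
    _ = 32 * M₀ / R ^ 3 * ‖A‖ ^ 2 := by
      field_simp
      ring

omit [DecidableEq Λ] in
/-- The sum `V(A) = Σ_{p ∈ Pl} φ_p(A)` is analytic on the ball when every `φ_p` is. [folklore] -/
theorem analyticOnNhd_sum {R : ℝ} (ha : ∀ p ∈ Pl, AnalyticOnNhd ℂ (φ p) (ball 0 R)) :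
    AnalyticOnNhd ℂ (fun A => ∑ p ∈ Pl, φ p A) (ball (0 : Λ → 𝔄) R) := by
  have hf : (fun A => ∑ p ∈ Pl, φ p A) = ∑ p ∈ Pl, φ p := by
    funext y
    simp
  rw [hf]
  exact Finset.analyticOnNhd_sum Pl ha

/-- `locGrad V` is differentiable on the ball where `V` is analytic (coordinatewise `DV(·) ∘ ι_b`). [folklore] -/
theorem differentiableOn_locGrad {V : (Λ → 𝔄) → ℂ} {R : ℝ} (hV : AnalyticOnNhd ℂ V (ball 0 R)) :
    DifferentiableOn ℂ (locGrad V) (ball (0 : Λ → 𝔄) R) :=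
  differentiableOn_pi.2 fun b => hV.fderiv.differentiableOn.clm_comp (differentiableOn_const (sgl b))

/-- **THE BOND-LOCAL (98) BOUND.**  For `V(A) = Σ_{p ∈ Pl} φ_p(A)` with every `φ_p` analytic and bounded by `M₀ ≥ 0` on
`ball 0 R` and LOCAL to `supp p` (`φ_p (A + Pi.single b X) = φ_p A` for `b ∉ supp p`), and at most `m` plaquettes through any bond (`#st(b) ≤ m`): on `ball 0 (R∕2)`,
`‖tail₂ (locGrad V) A‖_sup ≤ (32·m·M₀∕R³)·‖A‖²` — a constant made of the INCIDENCE number and ONE plaquette's data,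
independent of `#Pl` and of `#Λ` (the volume). [folklore] -/
theorem norm_tail₂_locGrad_le {R M₀ : ℝ} {m : ℕ} (hR : 0 < R) (hM₀ : 0 ≤ M₀)
    (ha : ∀ p ∈ Pl, AnalyticOnNhd ℂ (φ p) (ball 0 R))
    (hM : ∀ p ∈ Pl, ∀ A ∈ ball (0 : Λ → 𝔄) R, ‖φ p A‖ ≤ M₀)
    (hloc : ∀ p ∈ Pl, ∀ A : Λ → 𝔄, ∀ b ∉ supp p, ∀ X : 𝔄, φ p (A + Pi.single b X) = φ p A)
    (hm : ∀ b : Λ, (Pl.filter (fun p => b ∈ supp p)).card ≤ m) :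
    ∀ A ∈ ball (0 : Λ → 𝔄) (R / 2),
      ‖tail₂ (locGrad (fun A => ∑ p ∈ Pl, φ p A)) A‖ ≤ 32 * m * M₀ / R ^ 3 * ‖A‖ ^ 2 := by
  intro A hA
  have hsub : ball (0 : Λ → 𝔄) (R / 2) ⊆ ball 0 R := ball_subset_ball (by linarith)
  have h0 : (0 : Λ → 𝔄) ∈ ball (0 : Λ → 𝔄) R := mem_ball_self hR
  have hVa : AnalyticOnNhd ℂ (fun A => ∑ p ∈ Pl, φ p A) (ball (0 : Λ → 𝔄) R) := analyticOnNhd_sum Pl φ ha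
  have hG : ∀ b, ∀ p ∈ Pl, DifferentiableAt ℂ (fun A => (fderiv ℂ (φ p) A).comp (sgl b)) 0 := fun b p hp =>
    ((ha p hp).fderiv 0 h0).differentiableAt.clm_comp (differentiableAt_const _)
  have hbond : ∀ b, ‖tail₂ (locGrad (fun A => ∑ p ∈ Pl, φ p A)) A b‖ ≤ 32 * m * M₀ / R ^ 3 * ‖A‖ ^ 2 := by
    intro b
    -- the `b`-coordinate of the tail is the tail of the `b`-coordinate
    rw [tail₂_pi_apply (W := locGrad (fun A => ∑ p ∈ Pl, φ p A))
      (fun b => ((hVa.fderiv 0 h0).differentiableAt.clm_comp (differentiableAt_const (sgl b)))) A b]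
    -- on the ball the `b`-coordinate is the sum over `st(b)`
    have heq : ∀ A' ∈ ball (0 : Λ → 𝔄) R, locGrad (fun A => ∑ p ∈ Pl, φ p A) A' b =
        ∑ p ∈ Pl.filter (fun p => b ∈ supp p), (fderiv ℂ (φ p) A').comp (sgl b) := fun A' hA' =>
      locGrad_sum_eq_filter Pl φ supp (fun p hp => ((ha p hp) A' hA').differentiableAt) hloc b
    have hnhds : (fun A' => locGrad (fun A => ∑ p ∈ Pl, φ p A) A' b) =ᶠ[𝓝 0]
        fun A' => ∑ p ∈ Pl.filter (fun p => b ∈ supp p), (fderiv ℂ (φ p) A').comp (sgl b) :=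
      Filter.eventuallyEq_of_mem (ball_mem_nhds (0 : Λ → 𝔄) hR) fun A' hA' => heq A' hA'
    rw [tail₂_congr hnhds (heq A (hsub hA)),
      tail₂_sum _ (fun p hp => hG b p (Finset.mem_of_mem_filter p hp)) A]
    calc ‖∑ p ∈ Pl.filter (fun p => b ∈ supp p), tail₂ (fun A => (fderiv ℂ (φ p) A).comp (sgl b)) A‖
        ≤ ∑ p ∈ Pl.filter (fun p => b ∈ supp p), 32 * M₀ / R ^ 3 * ‖A‖ ^ 2 :=
          norm_sum_le_of_le _ fun p hp => norm_tail₂_fderiv_comp_sgl_le hR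
            (ha p (Finset.mem_of_mem_filter p hp)) (hM p (Finset.mem_of_mem_filter p hp)) b A hA
      _ = ((Pl.filter (fun p => b ∈ supp p)).card : ℝ) * (32 * M₀ / R ^ 3 * ‖A‖ ^ 2) := by
          rw [Finset.sum_const, nsmul_eq_mul]
      _ ≤ (m : ℝ) * (32 * M₀ / R ^ 3 * ‖A‖ ^ 2) := by
          gcongr
          exact_mod_cast hm b
      _ = 32 * m * M₀ / R ^ 3 * ‖A‖ ^ 2 := by ring
  exact (pi_norm_le_iff_of_nonneg (by positivity)).2 hbond

/-- **THE (98) SHAPE FOR A LOCAL SUM** (the hypothesis `hW : Prop4Hyp (W𝒱 V) C₄ a₃` of END-II, for the order-≥3 part of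
a sum of local analytic plaquette functionals at ONE grid): `Prop4Hyp (tail₂ (locGrad V)) (32·m·M₀∕R³) (R∕2)`.
Nothing printed is asserted: this is [Balaban1985Variational] (90)/(97) TYPE with the constant's dependence «on the
incidence number and one plaquette only» made explicit; the multi-scale weights of (97) on `Ω_j`, `j ≥ 1`, and the
`HD`-terms of (80) are NOT here. [folklore] -/
theorem prop4Hyp_locGrad {R M₀ : ℝ} {m : ℕ} (hR : 0 < R) (hM₀ : 0 ≤ M₀)
    (ha : ∀ p ∈ Pl, AnalyticOnNhd ℂ (φ p) (ball 0 R))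
    (hM : ∀ p ∈ Pl, ∀ A ∈ ball (0 : Λ → 𝔄) R, ‖φ p A‖ ≤ M₀)
    (hloc : ∀ p ∈ Pl, ∀ A : Λ → 𝔄, ∀ b ∉ supp p, ∀ X : 𝔄, φ p (A + Pi.single b X) = φ p A)
    (hm : ∀ b : Λ, (Pl.filter (fun p => b ∈ supp p)).card ≤ m) :
    Prop4Hyp (tail₂ (locGrad (fun A => ∑ p ∈ Pl, φ p A))) (32 * m * M₀ / R ^ 3) (R / 2) where
  quad Y hY := norm_tail₂_locGrad_le Pl φ supp hR hM₀ ha hM hloc hm Y (mem_ball_zero_iff.2 hY)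
  differentiableOn := by
    have h : {Y : Λ → 𝔄 | ‖Y‖ < R / 2} = ball (0 : Λ → 𝔄) (R / 2) := by
      ext Y
      simp
    rw [h]
    exact (differentiableOn_tail₂ (differentiableOn_locGrad (analyticOnNhd_sum Pl φ ha))).mono
      (ball_subset_ball (by linarith))

end Local

end Summit.QuantumFields.BalabanUV.T4Continuum.ShellMeasureLocalGradientTail

end
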